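import Literature.MathematicalPhysics.QuantumFieldTheory.Balaban1983to89.B9Eq347CoshRowOfLocalTower
import Literature.MathematicalPhysics.QuantumFieldTheory.Balaban1983to89.B9Eq342GreenPrimeDstarValueRowTower
import Literature.MathematicalPhysics.QuantumFieldTheory.Balaban1983to89.B9Eq342GreenPrimeTowerGradientRowClosed

/-!
# `Balaban1983to89.B9Eq342ResolventGradLetterTower` — T. Bałaban, *Propagators for lattice gauge theories in a background field*, Commun. Math. Phys. **99** (1985)
# 389–434 [Balaban1985BackgroundPropagators] Thm 3.1 (3.42) p. 397, SECOND ENTRY `|(∇_UG′λ)(x)|`, FOR THE COVARIANT MASSIVE RESOLVENT `G_1 = (Δ^η_U + 1)⁻¹` ON THE MODEL,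
# IN THE `cosh`-WEIGHTED CURRENCY: **the `Hgrad` letter of `B9Eq343CovariantResolventHolderAdjointRow` INHABITED at the tower — `∃ αg Θg κg` before the height: for every
# rate `a ≥ 0` with `a·d·L^{n+1} ≤ κg` and `2dη⁻²(cosh a − 1) ≤ ½`, every centre `x₀` and every `g` with `‖g(y)‖ ≤ G_s·W_{x₀}(y)`:
# `‖(D_UG_1g)(b)‖ ≤ Θg·G_s·W_{x₀}(b₋)`** — `G_1 = G′_k − G′_k(1 − (Δ′_{a′,k} − Δ^η_U))G_1` (`GpOfUk_eq_resolvent_add`), the OWNER's CLOSED local gradient row of `G′_k`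
# (`exists_gradRow_GpOfUk`) through `cosh_row_of_local`, Kato's weighted value row and the block-local penalty for the source `G_1g − (Δ′ − Δ^η_U)G_1g`

statement-level skeleton of published theorems with citation tags; proofs where landed; nothing here is a claim about the Yang–Mills mass gap

CITATION HEADER (lean-in-tree rule).  Audit cell `pub-balaban`, sub-cell `t4`, BINDER row NE9; filed by NE9 crux-team LEAF PROVER 01 (`b2b-balaban-t4-ne9-formalise-leaf-01`,
gen 93; bears_on: R4/N22).  Source READ first-hand (`paper:balaban1985-cmp99-background-propagators`): p. 397 Thm 3.1 (3.42), p. 394 (3.23)–(3.25), p. 399 (3.49).  COMPOSED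
BY NAME from the files in the imports.  Nothing printed is a hypothesis.

WHAT IS PROVED (sorry-free; proof lane — 0 `def`).
* **`exists_gradLetter_resolvent`** — the statement above (binders: the OWNER's gradient-row block + `hpos₁` for `Δ^η_U + 1`, then the rate `a`, the centre, the data).
HONEST SCOPE.  Bookkeeping over the OWNER's closed rows; the massive resolvent's gradient letter in the cosh currency is what the Hölder bootstrap consumes; the flat
two-point letter remains THE open input of (HLaH).  NOT summit progress (cell pub-balaban: NE9 NOT PRINTED ∕ NOT PROVED; «NE9 ⇐ the named binders»; row WALLED ON A MODEL
(O-NE9-1; #5 UNRULED); spine PROVED 0∕9; rung (B)+1 finite T⁴ — NOT infinite volume, NOT mass gap, NOT BetaPertH, NOT Clay).  HONEST DEPENDENCY (cell line): continuum YM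
on T⁴ ⇐ BetaPertH ∧ nine spine estimates (0/9 proved); BetaPertH ⇐ (D1) ∧ (D4) ∧ CAP+tail; G-an2-4 gates asym, D1 and NE2/3/4.  NEW file; nothing modified.  Net new
unproved facts: 0.
-/

noncomputable section

open scoped InnerProductSpace ComplexConjugate BigOperators

namespace Literature.MathematicalPhysics.QuantumFieldTheory.Balaban1983to89.B9Eq342ResolventGradLetterTower

open B4Sect5Torus (TSite tdist tdist_nonneg)
open B4Sect5Proof (latticeConst latticeConst_nonneg)
open B4TorusKernel.MultiPeriod (circAbs)
open B7Prop1Explicit (U1)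
open B9SectCLatticeCarrier (Bond bpos btgt unshift)
open B9Eq311L2Pairing (WL2)
open B9Eq319QprimeTorus (fineP blockCoord)
open B11Eq103H1Complex (SiteL2K BondL2K covDerivL2K covLaplaceSiteK greenK apply_greenK)
open B9Eq310HessianOperator (adTransportW)
open B9Eq310HessianHermitian (adTransportW_adjoint)
open B9Eq315QTower (towerP UlevOf)
open B9Eq316TowerFlatIsOneStep (towerP_eq_fineP_pow siteCast)
open B9Eq324DeltaPrimeATower (laplacePrimeAk GpOfUk)
open B9Eq349BlockMultipliers (exists_block_clm_family)
open B9Eq342GreenPrimeTowerGradientRowClosed (exists_gradRow_GpOfUk)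
open B9Eq342GreenPrimeTowerSupBoundDecay (bigBlock_eq_iff)
open B9Eq342TowerBigBlocks (card_sites_bigBlock_le tdist_le_of_bigBlock_eq)
open B9Eq324PenaltyBlockLocal (norm_laplacePrimeAk_sub_covLaplace_apply_le_block_diagonal)
open B9Eq347LocalFromBlockDecay (norm_le_sqrt_mass_mul)
open B9Eq342CovariantResolventAdjointRowLetters (norm_apply_le_weighted_of_resolvent)
open B9Eq342GreenPrimeSupBound (adTransportW_inv_adTransportW norm_adTransportW_eq norm_adTransportW_inv_eq)
open B9Eq342GradientRowNaturalPerturbation (weight_site_shift_le)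
open B9Eq343CovariantResolventHolderLetters (weight_le_exp_mul_of_tdist_le)
open B9Eq347CoshRowOfLocalTower (cosh_row_of_local)
open B9Eq342GreenPrimeDstarValueRowTower (GpOfUk_eq_resolvent_add)

variable {d : ℕ} (L : ℕ) [NeZero L] (hL3 : 3 ≤ L)
  {𝔸 : Type*} [NormedRing 𝔸] [NormedAlgebra ℂ 𝔸] [CompleteSpace 𝔸] [NormOneClass 𝔸] [StarRing 𝔸]
  {W : Type*} [NormedAddCommGroup W] [InnerProductSpace ℂ W] [FiniteDimensional ℂ W] (φ : W ≃ₗ[ℂ] 𝔸)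
  {a' Mφ Mφ' : ℝ} (hMφ : 0 ≤ Mφ) (hMφ' : 0 ≤ Mφ') (hφ : ∀ w, ‖φ w‖ ≤ Mφ * ‖w‖) (hφ' : ∀ X, ‖φ.symm X‖ ≤ Mφ' * ‖X‖) (ha' : 0 < a')
  {r : ℝ} (hr0 : 0 ≤ r) (hr1 : r < 1)
  (τ : 𝔸 →ₗ[ℂ] ℂ) (hτ₂ : ∀ X Y : 𝔸, τ (X * Y) = τ (Y * X)) (hφτ : ∀ X Y : 𝔸, ⟪φ.symm X, φ.symm Y⟫_ℂ = τ (star X * Y))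

include hL3 hMφ hMφ' hφ hφ' ha' hr0 hr1 hτ₂ hφτ in
/-- **THE `cosh`-WEIGHTED GRADIENT LETTER OF `G_1 = (Δ^η_U + 1)⁻¹` ON THE MODEL, CLOSED**: `∃ αg Θg κg` before the height such that on print's diagonal window, for every
background of the model (`α ≤ αg`), ANY positivity witnesses, every rate `0 ≤ a` with `a·d·L^{n+1} ≤ κg` and `2dη⁻²(cosh a − 1) ≤ ½`, every centre `x₀` and data
`‖g(y)‖ ≤ G_s·W_{x₀}(y)`: `‖(D_UG_1g)(b)‖ ≤ Θg·G_s·W_{x₀}(b₋)`. [cite: Balaban1985BackgroundPropagators, Thm 3.1 (3.42) p.397, (3.23)–(3.25) p.394, (3.49) p.399] -/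
theorem exists_gradLetter_resolvent (hd : 1 ≤ d) :
    ∃ αg Θg κg : ℝ, 0 < αg ∧ 0 ≤ Θg ∧ 0 < κg ∧
      ∀ (n : ℕ) (η : ℝ), η * (L : ℝ) ^ (n + 1) = 1 →
      ∀ (c₀ c₁ : ℝ) [Fact (0 < c₀)] [Fact (0 < c₁)], c₀ * ((L : ℝ) ^ (n + 1)) ^ d = c₁ →
      ∀ (m : Fin d → ℕ) [∀ i, NeZero (m i)] (U : Bond d (towerP L m (n + 1)) → 𝔸ˣ),
      ∀ (α : ℝ), 0 ≤ α → α ≤ αg → (∀ b, U b ∈ U1 𝔸) → (∀ b, ‖(U b : 𝔸) - 1‖ ≤ α * η) →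
        (∀ (x : TSite d (towerP L m (n + 1))) (μ : Fin d), ‖(U (x, μ) : 𝔸) - U (unshift μ x, μ)‖ ≤ α * η ^ 2) →
      ∀ (εU : ℕ → ℝ), (∀ j, 0 ≤ εU j) → (∀ j < n + 1, εU j ≤ α * r ^ j) →
        (∀ (j : ℕ) (b : Bond d (towerP L m (j + 1))), ‖(UlevOf L m (n + 1) U j b : 𝔸) - 1‖ ≤ εU j) →
        (∀ (j : ℕ) (b : Bond d (towerP L m (j + 1))), UlevOf L m (n + 1) U j b ∈ U1 𝔸) →
        (∀ b, star (U b : 𝔸) = ((U b)⁻¹ : 𝔸ˣ)) →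
        (∀ (j : ℕ) (b : Bond d (towerP L m (j + 1))) (w : W), ‖adTransportW φ (UlevOf L m (n + 1) U j) b w‖ ≤ ‖w‖) →
      ∀ (hpos' : ∀ x : SiteL2K ℂ d (towerP L m (n + 1)) c₀ W, x ≠ 0 → 0 < RCLike.re ⟪x, laplacePrimeAk L m n φ η U a' (c₁ := c₁) x⟫_ℂ)
        (hpos₁ : ∀ x : SiteL2K ℂ d (towerP L m (n + 1)) c₀ W, x ≠ 0 →
          0 < RCLike.re ⟪x, ((covLaplaceSiteK (c₀ := c₀) ((η : ℂ))⁻¹ (adTransportW φ U) (adTransportW φ fun b => (U b)⁻¹) + (1 : ℂ) • LinearMap.id :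
            SiteL2K ℂ d (towerP L m (n + 1)) c₀ W →ₗ[ℂ] SiteL2K ℂ d (towerP L m (n + 1)) c₀ W)) x⟫_ℂ)
        (a : ℝ), 0 ≤ a → a * d * (L : ℝ) ^ (n + 1) ≤ κg → 2 * (d : ℝ) * η⁻¹ ^ 2 * (Real.cosh a - 1) ≤ 1 / 2 →
      ∀ (x₀ : TSite d (towerP L m (n + 1))) (g : SiteL2K ℂ d (towerP L m (n + 1)) c₀ W) (Gs : ℝ), 0 ≤ Gs →
        (∀ y, ‖WL2.equiv ℂ (fun _ : TSite d (towerP L m (n + 1)) => c₀) W g y‖ ≤ Gs * ∏ μ, Real.cosh (a * (circAbs (towerP L m (n + 1) μ)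
          ((((x₀ μ : ℕ) : ZMod (towerP L m (n + 1) μ)) - ((y μ : ℕ) : ZMod (towerP L m (n + 1) μ))).val) : ℝ))) →
      ∀ b : Bond d (towerP L m (n + 1)),
        ‖WL2.equiv ℂ (fun _ : Bond d (towerP L m (n + 1)) => c₀) W (covDerivL2K ℂ c₀ ((η : ℂ))⁻¹ (adTransportW φ U) (greenK _ hpos₁ g)) b‖ ≤
          Θg * Gs * ∏ μ, Real.cosh (a * (circAbs (towerP L m (n + 1) μ)
            ((((x₀ μ : ℕ) : ZMod (towerP L m (n + 1) μ)) - ((bpos b μ : ℕ) : ZMod (towerP L m (n + 1) μ))).val) : ℝ)) := by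
  classical
  have hL2 : 2 ≤ L := le_trans (by norm_num) hL3
  obtain ⟨α₂, BD, κD, hα₂, hBD, hκD, HD⟩ := exists_gradRow_GpOfUk L φ hMφ hMφ' hφ hφ' ha' hr0 hr1 τ hτ₂ hφτ hd hL2
  -- the constants
  set Cl : ℝ := BD * Real.exp (κD / 2) * latticeConst d (κD / 2) with hCl
  have hKc : 0 ≤ latticeConst d (κD / 2) := latticeConst_nonneg d (by positivity)
  have hCl0 : 0 ≤ Cl := by positivity
  refine ⟨α₂, Cl * Real.exp (κD / 2) * (1 + 2 * (1 + |a'| * Real.exp (κD / 2))), κD / 2, hα₂, by positivity, by positivity, ?_⟩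
  intro n η hηL c₀ c₁ _ _ hw m _ U α hα hαle hUb hUη hUgrad εU hεU hεg hUε hLb hUst hRlev hpos' hpos₁ a ha haκ hlam x₀ g Gs hGs hg b
  have hc₀ : (0 : ℝ) < c₀ := Fact.out
  have hc₁ : (0 : ℝ) < c₁ := Fact.out
  have hm : ∀ i, 1 ≤ m i := fun i => Nat.one_le_iff_ne_zero.mpr (NeZero.ne (m i))
  have hK1 : (1 : ℝ) ≤ (L : ℝ) ^ (n + 1) := one_le_pow₀ (by exact_mod_cast (by omega : 1 ≤ L))
  have hd1 : (1 : ℝ) ≤ d := by exact_mod_cast hd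
  have hadK : a * d * (L : ℝ) ^ (n + 1) ≤ κD / 2 := haκ
  have ha1 : a ≤ κD / 2 := by
    have : a ≤ a * d * (L : ℝ) ^ (n + 1) := by
      have h1 : a * 1 * 1 ≤ a * d * (L : ℝ) ^ (n + 1) := mul_le_mul (mul_le_mul_of_nonneg_left hd1 ha) hK1 zero_le_one (by positivity)
      simpa using h1
    exact this.trans hadK
  have hexpa : Real.exp a ≤ Real.exp (κD / 2) := Real.exp_le_exp.2 ha1
  have hexpK : Real.exp (a * d * ((L : ℝ) ^ (n + 1) - 1)) ≤ Real.exp (κD / 2) :=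
    Real.exp_le_exp.2 (by nlinarith [mul_nonneg ha (Nat.cast_nonneg (α := ℝ) d)])
  have hlam' : 2 * (d : ℝ) * η⁻¹ ^ 2 * (Real.cosh a - 1) < 1 := by linarith
  have hlam2 : (1 - 2 * (d : ℝ) * η⁻¹ ^ 2 * (Real.cosh a - 1))⁻¹ ≤ 2 := by rw [inv_le_comm₀ (by linarith) two_pos]; linarith
  have hRS : ∀ (b : Bond d (towerP L m (n + 1))) (v u : W), ⟪adTransportW φ U b v, u⟫_ℂ = ⟪v, adTransportW φ (fun b => (U b)⁻¹) b u⟫_ℂ :=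
    adTransportW_adjoint φ τ hτ₂ hUst hφτ
  -- the big-block projections
  obtain ⟨PS, hPS⟩ := exists_block_clm_family (𝕜 := ℂ) (w := fun _ : TSite d (towerP L m (n + 1)) => c₀) (V := W)
    (fun x : TSite d (towerP L m (n + 1)) => blockCoord (L ^ (n + 1)) m (siteCast (towerP_eq_fineP_pow L m (n + 1)) x))
  have hPS' : ∀ (y : TSite d m) (f : SiteL2K ℂ d (towerP L m (n + 1)) c₀ W) (x : TSite d (towerP L m (n + 1))),
      WL2.equiv ℂ (fun _ : TSite d (towerP L m (n + 1)) => c₀) W (PS y f) x =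
        if (∀ i, (x i : ℕ) / L ^ (n + 1) = (y i : ℕ)) then WL2.equiv ℂ (fun _ : TSite d (towerP L m (n + 1)) => c₀) W f x else 0 := by
    intro y f x; rw [hPS]; exact if_congr (bigBlock_eq_iff L m n x y) rfl rfl
  have hμS : ∀ y : TSite d m, ∑ x : TSite d (towerP L m (n + 1)),
      (if blockCoord (L ^ (n + 1)) m (siteCast (towerP_eq_fineP_pow L m (n + 1)) x) = y then c₀ else 0) ≤ c₁ := by
    intro y
    rw [← Finset.sum_filter, Finset.sum_const, nsmul_eq_mul, ← hw]
    have h := card_sites_bigBlock_le L m (n + 1) y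
    have h' : ((Finset.univ.filter (fun x : TSite d (towerP L m (n + 1)) =>
        blockCoord (L ^ (n + 1)) m (siteCast (towerP_eq_fineP_pow L m (n + 1)) x) = y)).card : ℝ) ≤ ((L : ℝ) ^ (n + 1)) ^ d := by
      exact_mod_cast h
    rw [mul_comm]
    exact mul_le_mul_of_nonneg_left h' hc₀.le
  -- `D_UG′_k` read on the site functions and its cosh-weighted row (the OWNER's local row through `cosh_row_of_local`)
  obtain ⟨T, hT⟩ : ∃ T : (TSite d (towerP L m (n + 1)) → W) →ₗ[ℂ] (Bond d (towerP L m (n + 1)) → W), ∀ q bb, T q bb =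
      WL2.equiv ℂ (fun _ : Bond d (towerP L m (n + 1)) => c₀) W (covDerivL2K ℂ c₀ ((η : ℂ))⁻¹ (adTransportW φ U)
        (GpOfUk L m n φ η U a' (c₁ := c₁) hpos' ((WL2.equiv ℂ (fun _ : TSite d (towerP L m (n + 1)) => c₀) W).symm q))) bb :=
    ⟨(WL2.linearEquiv ℂ ℂ (fun _ : Bond d (towerP L m (n + 1)) => c₀)).toLinearMap ∘ₗ (covDerivL2K ℂ c₀ ((η : ℂ))⁻¹ (adTransportW φ U) ∘ₗ
      GpOfUk L m n φ η U a' (c₁ := c₁) hpos') ∘ₗ (WL2.linearEquiv ℂ ℂ (fun _ : TSite d (towerP L m (n + 1)) => c₀)).symm.toLinearMap, fun _ _ => rfl⟩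
  have hloc : ∀ (v' : TSite d m) (q : TSite d (towerP L m (n + 1)) → W) (F' : ℝ),
      (∀ y, blockCoord (L ^ (n + 1)) m (siteCast (towerP_eq_fineP_pow L m (n + 1)) y) ≠ v' → q y = 0) → (∀ y, ‖q y‖ ≤ F') →
      ∀ bb, ‖T q bb‖ ≤ BD * Real.exp (-((a * d * (L : ℝ) ^ (n + 1) + κD / 2) *
        tdist m (blockCoord (L ^ (n + 1)) m (siteCast (towerP_eq_fineP_pow L m (n + 1)) (btgt bb))) v')) * F' := by
    intro v' q F' hqv hqF bb
    have hF' : 0 ≤ F' := by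
      obtain ⟨y0⟩ : Nonempty (TSite d (towerP L m (n + 1))) := ⟨x₀⟩
      exact (norm_nonneg _).trans (hqF x₀)
    rw [hT]
    have h := HD n η hηL c₀ c₁ hw m U hRS α hα hαle hUb hUη hUgrad εU hεU hεg hUε hLb hUst hRlev hpos' PS hPS v'
      ((WL2.equiv ℂ (fun _ : TSite d (towerP L m (n + 1)) => c₀) W).symm q) F' hF'
      (fun z hz => by rw [Equiv.apply_symm_apply]; exact hqv z hz) (fun z => by rw [Equiv.apply_symm_apply]; exact hqF z) bb
    refine h.trans ?_
    rw [mul_right_comm]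
    refine mul_le_mul_of_nonneg_right (mul_le_mul_of_nonneg_left (Real.exp_le_exp.2 ?_) hBD) hF'
    have hD0 := tdist_nonneg m (blockCoord (L ^ (n + 1)) m (siteCast (towerP_eq_fineP_pow L m (n + 1)) (btgt bb))) v'
    nlinarith [mul_nonneg (mul_nonneg ha (Nat.cast_nonneg (α := ℝ) d)) (le_trans zero_le_one hK1)]
  have hκa : a * d * (L : ℝ) ^ (n + 1) < a * d * (L : ℝ) ^ (n + 1) + κD / 2 := by linarith
  have hrowT : ∀ (q : TSite d (towerP L m (n + 1)) → W) (Nq : ℝ), 0 ≤ Nq →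
      (∀ y, ‖q y‖ ≤ Nq * ∏ μ, Real.cosh (a * (circAbs (towerP L m (n + 1) μ)
        ((((x₀ μ : ℕ) : ZMod (towerP L m (n + 1) μ)) - ((y μ : ℕ) : ZMod (towerP L m (n + 1) μ))).val) : ℝ))) →
      ∀ bb, ‖T q bb‖ ≤ Cl * Real.exp (κD / 2) * Nq * ∏ μ, Real.cosh (a * (circAbs (towerP L m (n + 1) μ)
        ((((x₀ μ : ℕ) : ZMod (towerP L m (n + 1) μ)) - ((bpos bb μ : ℕ) : ZMod (towerP L m (n + 1) μ))).val) : ℝ)) := by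
    intro q Nq hNq hq bb
    have h := cosh_row_of_local L m n T btgt hBD ha hκa hloc x₀ q hNq hq bb
    have e : a * d * (L : ℝ) ^ (n + 1) + κD / 2 - a * d * (L : ℝ) ^ (n + 1) = κD / 2 := by ring
    rw [e] at h
    refine h.trans ?_
    have hW := weight_site_shift_le ha x₀ bb.1 bb.2
    calc BD * Real.exp (a * d * ((L : ℝ) ^ (n + 1) - 1)) * latticeConst d (κD / 2) * Nq * _
        ≤ BD * Real.exp (κD / 2) * latticeConst d (κD / 2) * Nq * (Real.exp a * ∏ μ, Real.cosh (a * (circAbs (towerP L m (n + 1) μ)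
            ((((x₀ μ : ℕ) : ZMod (towerP L m (n + 1) μ)) - ((bb.1 μ : ℕ) : ZMod (towerP L m (n + 1) μ))).val) : ℝ))) := by
          gcongr
      _ ≤ BD * Real.exp (κD / 2) * latticeConst d (κD / 2) * Nq * (Real.exp (κD / 2) * ∏ μ, Real.cosh (a * (circAbs (towerP L m (n + 1) μ)
            ((((x₀ μ : ℕ) : ZMod (towerP L m (n + 1) μ)) - ((bb.1 μ : ℕ) : ZMod (towerP L m (n + 1) μ))).val) : ℝ))) := by
          gcongr
      _ = _ := by rw [hCl]; ring
  -- `w₁ = G_1 g`: Kato's weighted value row and the correction source `g′ = w₁ − (Δ′ − Δ^η_U)w₁`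
  set w₁ : SiteL2K ℂ d (towerP L m (n + 1)) c₀ W := greenK _ hpos₁ g with hw₁
  have hw₁eq : covLaplaceSiteK ((η⁻¹ : ℝ) : ℂ) (adTransportW φ U) (adTransportW φ fun b => (U b)⁻¹) w₁ + ((1 : ℝ) : ℂ) • w₁ = g := by
    have h := apply_greenK hpos₁ g
    rw [Complex.ofReal_inv, Complex.ofReal_one]
    simpa only [LinearMap.add_apply, LinearMap.smul_apply, LinearMap.id_apply] using h
  have hη0 : 0 < η := by
    rcases lt_trichotomy η 0 with h | h | h
    · nlinarith
    · rw [h, zero_mul] at hηL; exact absurd hηL zero_ne_one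
    · exact h
  have hw₁row : ∀ y, ‖WL2.equiv ℂ _ W w₁ y‖ ≤ 2 * Gs * ∏ μ, Real.cosh (a * (circAbs (towerP L m (n + 1) μ)
      ((((x₀ μ : ℕ) : ZMod (towerP L m (n + 1) μ)) - ((y μ : ℕ) : ZMod (towerP L m (n + 1) μ))).val) : ℝ)) := fun y => by
    have h := norm_apply_le_weighted_of_resolvent (c₀ := c₀) η⁻¹ (adTransportW φ U) (adTransportW φ fun b => (U b)⁻¹)
      (fun b w => adTransportW_inv_adTransportW φ U b w) (fun b w => (norm_adTransportW_eq φ U τ hτ₂ hUst hφτ b w).le)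
      (fun b w => (norm_adTransportW_inv_eq φ U τ hτ₂ hUst hφτ b w).le) one_pos hlam' hw₁eq x₀ hGs hg y
    exact h.trans (mul_le_mul_of_nonneg_right (mul_le_mul_of_nonneg_right hlam2 hGs) (by positivity))
  set g' : SiteL2K ℂ d (towerP L m (n + 1)) c₀ W := w₁ - (laplacePrimeAk L m n φ η U a' (c₁ := c₁) w₁ -
      covLaplaceSiteK ((η : ℂ))⁻¹ (adTransportW φ U) (adTransportW φ fun b => (U b)⁻¹) w₁) with hg'def
  have hg'row : ∀ y, ‖WL2.equiv ℂ _ W g' y‖ ≤ (2 * (1 + |a'| * Real.exp (κD / 2)) * Gs) * ∏ μ, Real.cosh (a * (circAbs (towerP L m (n + 1) μ)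
      ((((x₀ μ : ℕ) : ZMod (towerP L m (n + 1) μ)) - ((y μ : ℕ) : ZMod (towerP L m (n + 1) μ))).val) : ℝ)) := by
    intro y
    set y₀ := blockCoord (L ^ (n + 1)) m (siteCast (towerP_eq_fineP_pow L m (n + 1)) y) with hy₀
    set Wy : ℝ := ∏ μ, Real.cosh (a * (circAbs (towerP L m (n + 1) μ)
      ((((x₀ μ : ℕ) : ZMod (towerP L m (n + 1) μ)) - ((y μ : ℕ) : ZMod (towerP L m (n + 1) μ))).val) : ℝ)) with hWy
    have hWy0 : 0 < Wy := B9Eq342CoshWeightSite.weight_site_pos (towerP L m (n + 1)) a x₀ y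
    have hyy : ∀ i, (y i : ℕ) / L ^ (n + 1) = (y₀ i : ℕ) := (bigBlock_eq_iff L m n y y₀).1 rfl
    -- the block of `y`: sup of `w₁` against the weight at `y`
    have hE0 : 0 ≤ 2 * Gs * (Real.exp (κD / 2) * Wy) := by positivity
    have hpen := norm_laplacePrimeAk_sub_covLaplace_apply_le_block_diagonal L m n φ U hPS' hRlev hw η a' w₁ y y₀ hyy
    have hmass : ‖PS y₀ w₁‖ ≤ Real.sqrt c₁ * (2 * Gs * (Real.exp (κD / 2) * Wy)) :=
      norm_le_sqrt_mass_mul (w := fun _ : TSite d (towerP L m (n + 1)) => c₀)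
        (π := fun x : TSite d (towerP L m (n + 1)) => blockCoord (L ^ (n + 1)) m (siteCast (towerP_eq_fineP_pow L m (n + 1)) x))
        y₀ (hμS y₀) (PS y₀ w₁) hE0 (fun x hx => by rw [hPS, if_neg hx]) (fun x => by
          rw [hPS]
          by_cases hx : blockCoord (L ^ (n + 1)) m (siteCast (towerP_eq_fineP_pow L m (n + 1)) x) = y₀
          · rw [if_pos hx]
            have hdx : tdist (towerP L m (n + 1)) x y ≤ (L : ℝ) ^ (n + 1) - 1 := tdist_le_of_bigBlock_eq L m (n + 1) hm (by rw [hx, hy₀])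
            have hWx := weight_le_exp_mul_of_tdist_le ha x₀ y x hdx
            exact (hw₁row x).trans (mul_le_mul_of_nonneg_left (hWx.trans (mul_le_mul_of_nonneg_right hexpK hWy0.le)) (by positivity))
          · rw [if_neg hx, norm_zero]; exact hE0)
    have hsq : (Real.sqrt c₁)⁻¹ * Real.sqrt c₁ = 1 := inv_mul_cancel₀ (Real.sqrt_pos.2 hc₁).ne'
    rw [hg'def, WL2.equiv_sub, Pi.sub_apply]
    refine (norm_sub_le _ _).trans ?_
    calc ‖WL2.equiv ℂ _ W w₁ y‖ + ‖WL2.equiv ℂ _ W (laplacePrimeAk L m n φ η U a' (c₁ := c₁) w₁ -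
            covLaplaceSiteK ((η : ℂ))⁻¹ (adTransportW φ U) (adTransportW φ fun b => (U b)⁻¹) w₁) y‖
        ≤ 2 * Gs * Wy + |a'| * (Real.sqrt c₁)⁻¹ * (Real.sqrt c₁ * (2 * Gs * (Real.exp (κD / 2) * Wy))) :=
          add_le_add (hw₁row y) (hpen.trans (mul_le_mul_of_nonneg_left hmass (by positivity)))
      _ = (2 * (1 + |a'| * ((Real.sqrt c₁)⁻¹ * Real.sqrt c₁) * Real.exp (κD / 2)) * Gs) * Wy := by ring
      _ = (2 * (1 + |a'| * Real.exp (κD / 2)) * Gs) * Wy := by rw [hsq, mul_one]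
  -- the identity `G_1g = G′_kg − G′_kg′` and the assembly
  have hid := GpOfUk_eq_resolvent_add L m n φ η U a' hpos' hpos₁ g
  rw [← hw₁, ← hg'def] at hid
  have hw₁eq' : w₁ = GpOfUk L m n φ η U a' (c₁ := c₁) hpos' g - GpOfUk L m n φ η U a' (c₁ := c₁) hpos' g' := eq_sub_of_add_eq hid.symm
  have hTg := hrowT (WL2.equiv ℂ _ W g) Gs hGs hg b
  have hTg' := hrowT (WL2.equiv ℂ _ W g') _ (by positivity) hg'row b
  rw [hT, Equiv.symm_apply_apply] at hTg hTg'
  rw [hw₁eq', map_sub, WL2.equiv_sub, Pi.sub_apply]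
  refine (norm_sub_le _ _).trans ((add_le_add hTg hTg').trans (le_of_eq ?_))
  ring

end Literature.MathematicalPhysics.QuantumFieldTheory.Balaban1983to89.B9Eq342ResolventGradLetterTower

end
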